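import Literature.AlgebraicGeometry.Resolution.GeneralLU
import Literature.AlgebraicGeometry.Resolution.StrictNormalCrossings
import Literature.AlgebraicGeometry.CossartPiltant200819.Bridge2019
import HarnessLib

/-!
# Cossart–Piltant 2019, Theorem 1.1 with conclusion (iii) and Corollary 1.2 ("good resolution")

V. Cossart, O. Piltant, *Resolution of singularities of arithmetical threefolds*, J. Algebra 529
(2019) 268–535 = arXiv:1412.0868 (*Resolution of Singularities of Arithmetical Threefolds II*),
Thm. 1.1 and Cor. 1.2 (identical in v1, v2 and the journal; read: arXiv v1 p. 3, held text
`paper:arxiv-1412.0868` chunk 3). The tree vendors Thm. 1.1 twice in WEAK forms: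
`Resolution.CossartPiltant2019` (schemes of finite type over a field, bare `HasResolution`) and
`Resolution.CossartPiltant2019General` (printed hypotheses; conclusions (i), (ii), birational),
whose docstring records "(iii) is not vendored (no normal crossings divisors in this tree)".
Since then `Resolution.IsStrictNormalCrossingsDivisor` (de Jong 2.4 / Stacks 0BI9) has landed,
so the printed statement can now be typed IN FULL. This file does that and nothing more:

* `IsGoodResolution π` — `π : X' → X` is proper birational with `X'` regular (`IsResolution`),
  an isomorphism over an open `U ⊆ X` whose points are exactly `Reg X`, and `π⁻¹(Sing X)` is a
  strict normal crossings divisor on `X'`: CP 2019 p. 3, "When property (iii) also holds, one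
  says that `π` is a good resolution or a log-resolution"; `HasGoodResolution X`.
* `CossartPiltant2019Thm11` — NAMED FACT, Thm. 1.1 VERBATIM with (i)(ii)(iii) (the projectivity
  complement over a specified finite affine covering is typed separately, see
  `Projective2019.lean`; it needs projective space over a ring).
* `CossartPiltant2019Cor12Good` — NAMED FACT, Cor. 1.2 ("`A` reduced complete Noetherian local of
  dimension three ⇒ `Spec A` has a good resolution of singularities which is projective") minus
  the word "projective" — and PROVED from Thm. 1.1 (`cor12Good_of_thm11`: complete Noetherian
  local rings are excellent, `Stacks07QW_complete`; affine schemes are separated; `Stacks07QU`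
  makes `Spec A` a quasi-excellent scheme).
* PROVED edges: `CossartPiltant2019Thm11.general` (drop (iii)) hence `.cossartPiltant2019`
  (`Stacks07QW_field`); `.hasGoodResolution_spec`; and
  `resolutionAffineThreefolds_of_thm11 : CossartPiltant2019Thm11 → Stacks07QW_field →
  CP2008.ResolutionAffineThreefolds` — the 2008/2009 threefold theorem (HAL Thm 2.1 (i)(ii)(iii),
  affine rendering of `Threefolds2008.lean`) for EVERY ground field, which the weak 2019 facts
  could not give (`Bridge2019.lean` stops at the local-uniformization layer because (ii)–(iii)
  are not recorded by `HasResolution`).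

Faithfulness. Hypotheses of Thm. 1.1 exactly as in `CossartPiltant2019General` (reduced,
separated, Noetherian, `Scheme.IsQuasiExcellent`, `topologicalKrullDim ≤ 3`). (ii) as there ("an
open `U` with `U = Reg X` and `π ∣_ U` an isomorphism"; `Reg X` is open for quasi-excellent `X`,
so this is implied by the printed (ii)). (iii): `Sing X = (Reg X)ᶜ` and `π⁻¹(Sing X)` as the SET
`π ⁻¹' (Reg X)ᶜ ⊆ X'`, to which the subset-predicate `IsStrictNormalCrossingsDivisor X'` applies
(its docstring: equivalent, on locally Noetherian `X'`, to "the reduced closed subscheme is a snc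
divisor" of Stacks 0BI9; `X'` is Noetherian here, being proper over Noetherian `X`). Cor. 1.2:
"complete" = `IsAdicComplete (maximalIdeal A) A`, "dimension three" = `ringKrullDim A = 3`.
What is NOT here: the projectivity clauses (Thm. 1.1 complement, Cor. 1.2 "which is projective",
Cor. 1.3) — `Projective2019.lean`; Thm. 1.4/1.5 (`Resolution.CossartPiltant2019Local`); any proof
content of the paper.
-/

noncomputable section

open CategoryTheory AlgebraicGeometry TopologicalSpace IsLocalRing

namespace Literature.AlgebraicGeometry.CossartPiltant200819.CP2019

open Literature.AlgebraicGeometry.Resolution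

universe u

/-! ## Good resolutions -/

/-- `π : X' ⟶ X` is a **good resolution** (= log-resolution) of `X` in the sense of
Cossart–Piltant 2019, p. 3: (i) `X'` regular and `π` proper birational (`IsResolution π`);
(ii) `π` is an isomorphism over the regular locus — there is an open `U ⊆ X` whose points are
exactly `Reg X` with `π ∣_ U : π⁻¹(U) → U` an isomorphism; (iii) `π⁻¹(Sing X) = π⁻¹((Reg X)ᶜ)` is
a strict normal crossings divisor on `X'` (`IsStrictNormalCrossingsDivisor`, de Jong 1996, 2.4).
[cite: CossartPiltant2019, Thm. 1.1 and p. 3 ("good resolution")] -/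
structure IsGoodResolution {X' X : Scheme.{u}} (π : X' ⟶ X) : Prop where
  /-- (i) + "proper birational": `π` is a resolution of singularities. -/
  isResolution : IsResolution π
  /-- (ii) `π` induces an isomorphism `π⁻¹(Reg X) ≅ Reg X`. -/
  isIso_restrict_regularLocus :
    ∃ U : X.Opens, (U : Set X) = Scheme.regularLocus X ∧ IsIso (π ∣_ U)
  /-- (iii) `π⁻¹(Sing X)` is a strict normal crossings divisor on `X'`. -/
  isStrictNormalCrossingsDivisor_preimage_singularLocus :
    IsStrictNormalCrossingsDivisor X' (π.base ⁻¹' (Scheme.regularLocus X)ᶜ)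

/-- `X` **has a good resolution**: some `π : X' ⟶ X` is a good resolution (Cossart–Piltant 2019,
Cor. 1.2: "has a good resolution of singularities"). [cite: CossartPiltant2019, Cor. 1.2] -/
def HasGoodResolution (X : Scheme.{u}) : Prop :=
  ∃ (X' : Scheme.{u}) (π : X' ⟶ X), IsGoodResolution π

/-- A good resolution is a resolution. [folklore] -/
theorem HasGoodResolution.hasResolution {X : Scheme.{u}} (h : HasGoodResolution X) :
    Scheme.HasResolution X := by
  obtain ⟨X', π, hπ⟩ := h
  exact ⟨X', π, hπ.isResolution⟩

/-- A regular scheme is its own good resolution: the identity, with `U = X = Reg X` and empty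
exceptional locus. [folklore] -/
theorem HasGoodResolution.of_isRegular {X : Scheme.{u}} (h : Scheme.IsRegular X) :
    HasGoodResolution X := by
  refine ⟨X, 𝟙 X, ⟨inferInstance, ⟨⊤, ?_, ?_, ?_⟩, h⟩, ⟨⊤, ?_, ?_⟩,
    IsStrictNormalCrossingsDivisor.of_eq_empty ?_⟩
  · simp
  · simp
  · infer_instance
  · simp [h.regularLocus_eq_univ]
  · infer_instance
  · simp [h.regularLocus_eq_univ]

/-! ## Theorem 1.1 (all three conclusions) -/

/-- NAMED FACT — **Cossart–Piltant 2019, Theorem 1.1**, VERBATIM: "Let `𝒳` be a reduced and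
separated Noetherian scheme which is quasi-excellent and of dimension at most three. There
exists a proper birational morphism `π : 𝒳' → 𝒳` with the following properties: (i) `𝒳'` is
everywhere regular; (ii) `π` induces an isomorphism `π⁻¹(Reg 𝒳) ≃ Reg 𝒳`; (iii) `π⁻¹(Sing 𝒳)` is a
strict normal crossings divisor on `𝒳'`." (Then: "If furthermore a finite affine covering
`𝒳 = 𝒰₁ ∪ ⋯ ∪ 𝒰ₙ` is specified, one may take `π⁻¹(𝒰ᵢ) → 𝒰ᵢ` projective" — not part of this
Prop.) "We emphasize that no assumption is made on the characteristic of `𝒳`." Rendered with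
the hypotheses of `Resolution.CossartPiltant2019General` and the conclusion `HasGoodResolution`;
strictly stronger than `CossartPiltant2019General` (`CossartPiltant2019Thm11.general`). Users
take `(h : CossartPiltant2019Thm11)`. [cite: CossartPiltant2019, Thm. 1.1] -/
def CossartPiltant2019Thm11 : Prop :=
  ∀ (X : Scheme.{u}) [X.IsSeparated] [IsNoetherian X] [IsReduced X],
    Scheme.IsQuasiExcellent X → topologicalKrullDim X ≤ 3 → HasGoodResolution X

namespace CossartPiltant2019Thm11

/-- Thm. 1.1 with (iii) gives the tree's `CossartPiltant2019General` (conclusions (i), (ii)).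
[cite: CossartPiltant2019, Thm. 1.1] -/
theorem general (h : CossartPiltant2019Thm11.{u}) : CossartPiltant2019General.{u} := by
  intro X _ _ _ hqe hdim
  obtain ⟨X', π, hπ⟩ := h X hqe hdim
  exact ⟨X', π, hπ.isResolution, hπ.isIso_restrict_regularLocus⟩

/-- Thm. 1.1 with (iii) gives the weak `CossartPiltant2019` over fields (finite type algebras over
a field are excellent, `Stacks07QW_field`). [cite: CossartPiltant2019, Thm. 1.1] -/
theorem cossartPiltant2019 (h : CossartPiltant2019Thm11.{u}) (h07 : Stacks07QW_field.{u}) :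
    CossartPiltant2019.{u} :=
  h.general.cossartPiltant2019 h07

/-- Thm. 1.1 for an affine scheme: `Spec A` has a good resolution for every reduced
quasi-excellent ring `A` of Krull dimension `≤ 3` (`Spec A` is separated and Noetherian;
`Stacks07QU` makes it a quasi-excellent scheme). [cite: CossartPiltant2019, Thm. 1.1] -/
theorem hasGoodResolution_spec (h : CossartPiltant2019Thm11.{u}) (h07 : Stacks07QU.{u})
    (A : Type u) [CommRing A] [_root_.IsReduced A] (hA : IsQuasiExcellentRing A)
    (hdim : ringKrullDim A ≤ 3) : HasGoodResolution (Spec (.of A)) := by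
  haveI : IsNoetherianRing A := hA.isNoetherianRing
  haveI : IsNoetherianRing (CommRingCat.of A) := ‹IsNoetherianRing A›
  have hqe := Scheme.isQuasiExcellent_of_locallyOfFiniteType_of_isQuasiExcellentRing h07 hA
    (𝟙 (Spec (.of A)))
  have hdim' : topologicalKrullDim (Spec (.of A)) ≤ 3 :=
    (le_of_eq (PrimeSpectrum.topologicalKrullDim_eq_ringKrullDim (R := A))).trans hdim
  exact h (Spec (.of A)) hqe hdim'

end CossartPiltant2019Thm11

/-! ## Corollary 1.2 (without "projective") -/

/-- NAMED FACT — **Cossart–Piltant 2019, Corollary 1.2**, VERBATIM: "Let `A` be a reduced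
complete Noetherian local ring of dimension three. Then `𝒳 := Spec A` has a good resolution of
singularities which is projective." — WITHOUT the word "projective" (typed in
`Projective2019.lean`): for every reduced complete Noetherian local ring `A` of Krull dimension
`3`, `Spec A` has a good resolution. PROVED from Thm. 1.1 below (`cor12Good_of_thm11`), exactly
as in print ("Since the class of quasi-excellent schemes is stable…": complete local rings are
excellent). Users may also take `(h : CossartPiltant2019Cor12Good)` directly.
[cite: CossartPiltant2019, Cor. 1.2] -/
def CossartPiltant2019Cor12Good : Prop :=
  ∀ (A : Type u) [CommRing A] [IsLocalRing A] [IsNoetherianRing A]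
    [IsAdicComplete (maximalIdeal A) A] [_root_.IsReduced A],
    ringKrullDim A = 3 → HasGoodResolution (Spec (.of A))

/-- **Cor. 1.2 (good resolution of `Spec A`, `A` reduced complete local Noetherian of dimension
three) from Thm. 1.1**: complete Noetherian local rings are excellent (`Stacks07QW_complete`),
hence quasi-excellent, and `Stacks07QU` spreads quasi-excellence over the affine opens of
`Spec A`. [cite: CossartPiltant2019, Cor. 1.2] -/
theorem cor12Good_of_thm11 (h : CossartPiltant2019Thm11.{u}) (h07 : Stacks07QU.{u})
    (h07c : Stacks07QW_complete.{u}) : CossartPiltant2019Cor12Good.{u} := by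
  intro A _ _ _ _ _ hdim
  exact h.hasGoodResolution_spec h07 A (h07c A).isQuasiExcellentRing (le_of_eq hdim)

/-! ## The 2008/2009 threefold theorem from Theorem 1.1 -/

/-- **CP 2019 Thm. 1.1 ⟹ CP 2008 Thm 2.1 = CP 2009 "Theorem" (i)(ii)(iii)** in the affine
rendering `CP2008.ResolutionAffineThreefolds` of `Threefolds2008.lean`, for every ground field
(the differential finiteness and characteristic hypotheses of the 2008 statement are not used):
a reduced affine `k`-scheme `Spec A` of finite type and dimension `≤ 3` is separated, Noetherian
and — finite type algebras over a field being excellent, `Stacks07QW_field` — quasi-excellent,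
and `dim Spec A = dim A`. [cite: CossartPiltant2019, Thm. 1.1 (introduction: "These results
extend to all characteristics … [CoP1] [CoP2]")] -/
theorem resolutionAffineThreefolds_of_thm11 (h : CossartPiltant2019Thm11.{u})
    (h07 : Stacks07QW_field.{u}) : CP2008.ResolutionAffineThreefolds.{u} := by
  intro p _ k _ _ _ A _ _ _ hft hdim
  haveI : IsNoetherianRing A := Algebra.FiniteType.isNoetherianRing k A
  haveI : IsNoetherianRing (CommRingCat.of A) := ‹IsNoetherianRing A›
  haveI : LocallyOfFiniteType (Spec.map (CommRingCat.ofHom (algebraMap k A))) := by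
    rw [HasRingHomProperty.Spec_iff (P := @LocallyOfFiniteType)]
    exact RingHom.finiteType_algebraMap.mpr hft
  have hqe : Scheme.IsQuasiExcellent (Spec (.of A)) :=
    Scheme.isQuasiExcellent_of_locallyOfFiniteType h07
      (Spec.map (CommRingCat.ofHom (algebraMap k A)))
  have hdim' : topologicalKrullDim (Spec (.of A)) ≤ 3 :=
    (le_of_eq (PrimeSpectrum.topologicalKrullDim_eq_ringKrullDim (R := A))).trans hdim
  obtain ⟨X', π, hπ⟩ := h (Spec (.of A)) hqe hdim'
  exact ⟨X', π, hπ.isResolution, hπ.isIso_restrict_regularLocus,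
    hπ.isStrictNormalCrossingsDivisor_preimage_singularLocus⟩

/-- Hence, under Thm. 1.1 and `Stacks07QW_field`, BOTH halves of the 2008 programme's top
statement hold on affine threefolds over any field: the good resolution
(`CP2008.ResolutionAffineThreefolds`) and the local uniformization theorem
(`CP2008.LU3DiffFinite`, via `Bridge2019.lean`). [cite: CossartPiltant2019, Thm. 1.1] -/
theorem cp2008_of_thm11 (h : CossartPiltant2019Thm11.{u}) (h07 : Stacks07QW_field.{u}) :
    CP2008.ResolutionAffineThreefolds.{u} ∧ CP2008.LU3DiffFinite.{u} :=
  ⟨resolutionAffineThreefolds_of_thm11 h h07,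
    CP2008.lu3DiffFinite_of_cossartPiltant2019 (h.cossartPiltant2019 h07)⟩

end Literature.AlgebraicGeometry.CossartPiltant200819.CP2019

end
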